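import Literature.MathematicalPhysics.QuantumLattice.SpinChainsGossetMozgunovProofs
import Literature.LinearAlgebra.Matrix.CommutingPosSemidefProduct
import HarnessLib

/-!
# Lemm–Mozgunov's finite-size criterion for frustration-free chains WITH BOUNDARY (open chains)

Trunk **T-QLATTICE**; theorem-only sequel of `SpinChainsKnabeBlockProofs.lean` (Knabe 1988, threshold `1/(n-1)`)
and `SpinChainsGossetMozgunovProofs.lean` (Gosset–Mozgunov 2016 Thm. 3, threshold `6/(n(n+1))`), in the same
vocabulary: a family `P : ℤ/N → M_n(ℂ)` of orthogonal projections on a ring, `P_i` commuting with `P_{i+d}` unless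
`d ∈ {0, ±1}`, blocks `A_i = Σ_{j<b} P_{i+j}` of `b` consecutive projections, `H = Σ_i P_i`.  No definition, no named
fact (net debt 0).  This discharges the "open chains (Lemm–Mozgunov)" half of the `TODO(general form)` recorded in
`Literature/Analysis/OperatorTheory/KnabeGapAmplification.lean`.

## The source, as printed

M. Lemm, E. Mozgunov, *Spectral gaps of frustration-free spin systems with boundary*, J. Math. Phys. **60** (2019)
051901 (arXiv:1801.08915), Part I.  Setting (§2.1): on `(ℂ^d)^{⊗m}`, `m ≥ 3`, nearest-neighbour projections
`h_{i,i+1}` (one fixed `P`), one-site boundary projections `Π_1`, `Π_m` (possibly `0`),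
`H_m := Π_1 + Π_m + Σ_{i=1}^{m-1} h_{i,i+1}` frustration-free, spectral gap `γ_m`; Definition 2.1: BULK gap `γ_n^B` =
gap of `H_n^B = Σ_{i=1}^{n-1} h_{i,i+1}`, EDGE gaps `γ_n^L`, `γ_n^R` = gaps of `H_n^L = Π_1 + Σ_{i=1}^{n-1} h_{i,i+1}`,
`H_n^R = Π_m + Σ_{i=m-n+1}^{m-1} h_{i,i+1}`, `γ_n^E := min{1, min_{2≤n'≤n} min{γ_{n'}^L, γ_{n'}^R}}`.

* "**Theorem 2.2 (Main result 1).** Let `m ≥ 8` and `4 ≤ n ≤ m/2`. We have the bound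
  `γ_m ≥ (1/(2⁸ √(6n))) (min{γ_n^B, γ_{n-1}^E} - 2√6 n^{-3/2})`."  [LM19, Thm. 2.2 (thm:main1)]
* "**Remark 2.3 (i).** The proof also yields a bound for `n = 3` …: `γ_m ≥ 2 (min{γ_3^B, γ_2^E} - 1/2)`."
* §4.1, (4.1)–(4.3): "we add an artificial `0`th site … `h_{0,1} := Π_1`, `h_{m,0} := Π_m` … we view the resulting
  chain as a periodic ring on `m+1` sites … `H_m = Σ_{i=1}^{m+1} h_{i,i+1}`"; Definition 4.2: sub-chain operators
  `A_{n,l} = Σ_{j=l}^{l+n-2} h_{j,j+1}`, deformations `B_{n,l} = Σ_j c_{j-l} h_{j,j+1}`;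
* §4.3 "**Proposition 4.3 (Knabe-type bound in 1D).** `Σ_l B²_{n,l} ≤ (Σ_j c_j²) H_m + (Σ_j c_j c_{j+1})(Q + F)`",
  `H_m² = H_m + Q + F`, the only input being "`h_i h_{i'} ≥ 0` for `d(i,i') ≥ 2`" (Lemma 4.4) — this is
  Gosset–Mozgunov's eq. (posdef) with general weights;
* §4.4 "**Proposition 4.4.** (i) Bulk terms. For every `1 ≤ l ≤ m-n+1`, `B²_{n,l} ≥ c_0 γ_n^B B_{n,l}`. (ii) Edge
  terms. For every `m-n+2 ≤ l ≤ m+1`, `B²_{n,l} ≥ c_0 γ_{n-1}^E B_{n,l}`", proved by splitting an edge block as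
  `B = B^R + B^L` with `[B^R, B^L] = 0` ("since `[h_m, h_{m+1}] = [Π_m, Π_1] = 0`"), `{B^R, B^L} ≥ 0`,
  `B² ≥ (B^R)² + (B^L)²`, and Lemma 4.5 (`γ^R_{m-l+1}, γ^L_{l-2+n-m} ≥ γ^E_{n-1}`; a lone `Π` is a projection,
  gap `1`);
* §4.5–4.6: weights `c_j = n^{3/2} + x((n-2)j - j²)`, `γ_m ≥ F(n)(μ_n - G(n))`, `μ_n = min{γ^E_{n-1}, γ^B_n}`,
  `F(n) ≥ 1/(2⁸√6 √n)`, `G(n) ≤ 2√6 n^{-3/2}`.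

## What is proved here, and how it relates to the printed proof

The ring trick of §4.1 is the HYPOTHESIS SHAPE below: a ring `ℤ/N` (`N = m + 1`) of bond projections with one
distinguished SEAM — two consecutive indices `s`, `s + 1` (the boundary projectors `Π_m`, `Π_1`) whose projections
COMMUTE (`hseam`).  The local-gap data are exactly Lemm–Mozgunov's: a bulk gap for the blocks of `b = n - 1`
consecutive bonds meeting neither `s` nor `s + 1` (`hbulk`, Prop. 4.4 (i)), and edge gaps for the `k ≤ b` bonds
ending at `s` (`hR`: `H^R_k`) and for the `k ≤ b` bonds starting at `s + 1` (`hL`: `H^L_k`).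

* `add_mul_add_sub_smul_posSemidef_of_commute` — the core of Prop. 4.4 (ii): `R, L ≥ 0` commuting, `R² ≥ εR`,
  `L² ≥ εL` ⇒ `(R+L)² ≥ ε(R+L)` (uses `{R, L} = 2RL ≥ 0`, Horn–Johnson 7.2.P21 (a) from the tree);
* `proj_mul_self_sub_smul_posSemidef` — a lone projection has every local gap `ε ≤ 1` (Lemma 4.5's case
  `m - l + 1 = 1`; the source's `min{1, …}`);
* ★ `lemmMozgunov_block_sq_sub_smul_posSemidef` — **Proposition 4.4 in operator form**: under `hbulk`, `hR`, `hL`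
  and `hseam`, EVERY block of `b` consecutive bonds of the ring has local gap `ε`: `A_i² - ε A_i ≥ 0` for all `i`;
* ★★ `lemmMozgunov_ring_sq_sub_smul_posSemidef` — the finite-size criterion for the open chain:
  `H² ≥ (5(b+1)(b+2) / (6(b-1)(b+3))) · (ε - 6/((b+1)(b+2))) · H`, `b ≥ 2`, `N ≥ max(b+2, 2b-1)`; with `n = b + 1`
  sites per block (`…_sites`): `H² ≥ (5/6)((n²+n)/(n²-4)) (ε - 6/(n(n+1))) H`, and the eigenvalue reading
  (`…_eigenvalue_eq_zero_or_le`): every non-zero eigenvalue of `H` is at least that constant;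
* ★ `lemmMozgunov_thm22_sq_sub_smul_posSemidef` / `lemmMozgunov_thm22_eigenvalue_eq_zero_or_le` — **Theorem 2.2
  with its printed constants**, `H² ≥ (1/(2⁸√(6n))) (ε - 2√6/n^{3/2}) H` (`n ≥ 4`), as a COROLLARY of the previous
  item (`(5/6)(n²+n)/(n²-4) ≥ 1/(2⁸√(6n))` and `6/(n(n+1)) ≤ 2√6 n^{-3/2}`);
* `lemmMozgunov_rem23_sq_sub_smul_posSemidef` — Remark 2.3 (i), `n = 3`: `H² ≥ 2(ε - 1/2) H`, from Knabe's
  block theorem with `b = 2`.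

DEVIATION FROM THE PRINTED ROUTE (stated honestly).  Steps 1–2 of §4 are followed verbatim (Prop. 4.3 is the
tree's `gossetMozgunov_weighted_sq_posSemidef`; Prop. 4.4 is `lemmMozgunov_block_sq_sub_smul_posSemidef`).  Step 3
(the weights `n^{3/2} + x((n-2)j - j²)` and the bound `B² ≥ c_0 μ B` by the SMALLEST weight) is replaced by
Gosset–Mozgunov's weights `(j+1)(b-j)` fed through the tree's SUMMED form of their Lemma 4,
`gossetMozgunov_sum_weighted_sq_sub_smul_posSemidef` (`Σ_i B_i² ≥ ε((Σ_j c_j)²/b) H` for every vector, by a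
per-block spectral Cauchy–Schwarz inequality and Cauchy–Schwarz across blocks — no translation invariance, see the
REMARK in `SpinChainsGossetMozgunovProofs.lean`).  Consequently the formal criterion carries Gosset–Mozgunov's
threshold `6/(n(n+1)) = Θ(n⁻²)` and constant `(5/6)(n²+n)/(n²-4)` also for chains WITH boundary, and the printed
Theorem 2.2 (threshold `2√6 n^{-3/2}`, constant `2⁻⁸(6n)^{-1/2}`) follows from it by comparing constants.  The
source states (Remark 4.1, §1.2.3) that the `Θ(n⁻²)` method of [GM] "does not apply because our Hamiltonians do not
commute with translations" and leaves the optimality of `n^{-3/2}` open; an `Θ(n⁻²)` threshold for open chains was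
subsequently PROVED IN PRINT by A. Anshu, Phys. Rev. B **101** (2020) 165104 (arXiv:1909.01516), Thm. 4.1, by a
different method (detectability lemma / coarse-grained Hamiltonian; unoptimised constants), so the strengthening
recorded here is a known fact, obtained along the Knabe–Gosset–Mozgunov route.  NOT formalised: Theorem 2.6 (the
weighted average of edge gaps), Remark 2.3 (iii) (the optimised threshold `G(n)`), Part II (2D; Theorems 3.x).

HONEST FRAMING: finite-dimensional linear algebra about frustration-free sums of projections (census row B15 of the
ym-ir cell: the ARCHETYPE of a "local gap at one finite size ⇒ uniform gap" criterion, here with a genuine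
boundary); nothing here concerns transfer matrices of lattice gauge theories (not frustration-free), and nothing
here bears on the Yang–Mills mass gap.

## References
* M. Lemm, E. Mozgunov, J. Math. Phys. **60** (2019) 051901, arXiv:1801.08915: §2.1 Def. 2.1, §2.3 Thm. 2.2,
  Rem. 2.3 (i), §4.1 (4.1)–(4.3), Def. 4.2, §4.3 Prop. 4.3, Lemma 4.4, §4.4 Prop. 4.4, Lemma 4.5, §4.5–4.6.
  [LemmMozgunov2019]
* D. Gosset, E. Mozgunov, J. Math. Phys. **57** (2016) 091901, arXiv:1512.00088, §2 Thm. 3, Lemma 4, §2.2.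
  [GossetMozgunov2016]
* A. Anshu, Phys. Rev. B **101** (2020) 165104, arXiv:1909.01516, Thm. 4.1 (open and closed chains, threshold
  `Θ(t⁻²)`). [Anshu2020]
* S. Knabe, J. Stat. Phys. **52** (1988) 627–638, §2. [Knabe1988]
-/

noncomputable section

open Matrix Complex Finset
open scoped ComplexOrder

namespace Literature.MathematicalPhysics.QuantumLattice

section LemmMozgunov

variable {n : Type*} [Fintype n] [DecidableEq n]

/-! ### Proposition 4.4 (ii): the gap of a sum of two commuting gapped positive operators -/

/-- **Lemm–Mozgunov's edge-block step** (proof of Prop. 4.4 (ii)): if `R, L ≥ 0` commute and `R² - εR ≥ 0`,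
`L² - εL ≥ 0`, then `(R + L)² - ε(R + L) ≥ 0` — since `(R+L)² - ε(R+L) = (R² - εR) + (L² - εL) + {R, L}` and the
anticommutator of two commuting positive matrices is `2RL ≥ 0` ("we observe that the operators `B^R ≥ 0` and
`B^L ≥ 0` commute … hence `{B^R, B^L} ≥ 0`, which implies `B² ≥ (B^R)² + (B^L)²`").
[cite: LemmMozgunov2019, §4.4 proof of Prop. 4.4 (ii)] -/
theorem add_mul_add_sub_smul_posSemidef_of_commute {R L : Matrix n n ℂ} (hR : R.PosSemidef)
    (hL : L.PosSemidef) (hRL : Commute R L) (ε : ℝ) (hRg : (R * R - (ε : ℂ) • R).PosSemidef)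
    (hLg : (L * L - (ε : ℂ) • L).PosSemidef) :
    ((R + L) * (R + L) - (ε : ℂ) • (R + L)).PosSemidef := by
  have hprod : (R * L).PosSemidef :=
    Literature.LinearAlgebra.Matrix.posSemidef_mul_of_posSemidef_of_commute hR hL hRL
  have hLR : L * R = R * L := hRL.symm.eq
  have hid : (R + L) * (R + L) - (ε : ℂ) • (R + L) =
      (R * R - (ε : ℂ) • R) + (L * L - (ε : ℂ) • L) + (R * L + R * L) := by
    rw [add_mul, mul_add, mul_add, hLR, smul_add]
    abel
  rw [hid]
  exact (hRg.add hLg).add (hprod.add hprod)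

omit [DecidableEq n] in
/-- **A lone projection has every local gap `ε ≤ 1`**: `P² - εP = (1 - ε)P ≥ 0` (Lemma 4.5, case `m - l + 1 = 1`:
"`B_{n,l}` has spectral gap equal to `1` (it is a projection)"; this is the `1` in `γ^E = min{1, …}`).
[cite: LemmMozgunov2019, §4.4 Lemma 4.5] -/
theorem proj_mul_self_sub_smul_posSemidef {P : Matrix n n ℂ} (hP : P.IsHermitian) (hPP : P * P = P)
    {ε : ℝ} (hε : ε ≤ 1) : (P * P - (ε : ℂ) • P).PosSemidef := by
  have h : P * P - (ε : ℂ) • P = ((1 - ε : ℝ) : ℂ) • P := by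
    rw [hPP, Complex.ofReal_sub, Complex.ofReal_one, sub_smul, one_smul]
  rw [h]
  exact (posSemidef_of_isHermitian_of_mul_self hP hPP).smul (Complex.zero_le_real.2 (by linarith))

/-! ### Proposition 4.4: every block of the seamed ring has the local gap -/

/-- ★ **Lemm–Mozgunov's Proposition 4.4 in operator form (bulk and edge blocks).**  Ring `ℤ/N` of bond projections
`P_i` (`P_iᴴ = P_i = P_i²`, `P_i` commuting with `P_{i+d}` for `d ∉ {0, ±1}`), `N ≥ b + 2`, with a SEAM at
`(s, s+1)`: `P_s P_{s+1} = P_{s+1} P_s` (the two boundary projectors `Π_m = P_s`, `Π_1 = P_{s+1}` of the open chain,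
eqs. (4.1)–(4.3)).  Suppose: (bulk, Prop. 4.4 (i)) every block `A_i = Σ_{j<b} P_{i+j}` meeting neither `s` nor
`s + 1` satisfies `A_i² - εA_i ≥ 0`; (right edge) for `1 ≤ k ≤ b` the `k` bonds ending at the seam,
`R_k = Σ_{j<k} P_{s+1-k+j} = P_{s-k+1} + ⋯ + P_s` (`= H^R_k`), satisfy `R_k² - εR_k ≥ 0`; (left edge) the `k` bonds
starting after the seam, `L_k = Σ_{j<k} P_{s+1+j}` (`= H^L_k`), satisfy `L_k² - εL_k ≥ 0`.  Then EVERY block has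
the local gap: `A_i² - εA_i ≥ 0` for all `i : ℤ/N` (an edge block is `R_k + L_{b-k}` with `[R_k, L_{b-k}] = 0`).
[cite: LemmMozgunov2019, §4.4 Prop. 4.4 (i)–(ii), Lemma 4.5] -/
theorem lemmMozgunov_block_sq_sub_smul_posSemidef {N : ℕ} [NeZero N] {b : ℕ} (hb : 1 ≤ b)
    (hN : b + 2 ≤ N) (P : ZMod N → Matrix n n ℂ) (hherm : ∀ i, (P i).IsHermitian)
    (hidem : ∀ i, P i * P i = P i)
    (hcomm : ∀ i d : ZMod N, d ≠ 0 → d ≠ 1 → d ≠ -1 → P i * P (i + d) = P (i + d) * P i)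
    (s : ZMod N) (hseam : P s * P (s + 1) = P (s + 1) * P s) (ε : ℝ)
    (hbulk : ∀ i : ZMod N, (∀ j < b, i + (j : ZMod N) ≠ s) → (∀ j < b, i + (j : ZMod N) ≠ s + 1) →
      ((∑ j ∈ range b, P (i + (j : ZMod N))) * (∑ j ∈ range b, P (i + (j : ZMod N))) -
        (ε : ℂ) • ∑ j ∈ range b, P (i + (j : ZMod N))).PosSemidef)
    (hR : ∀ k, 1 ≤ k → k ≤ b →
      ((∑ j ∈ range k, P (s + 1 - (k : ZMod N) + (j : ZMod N))) *
          (∑ j ∈ range k, P (s + 1 - (k : ZMod N) + (j : ZMod N))) -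
        (ε : ℂ) • ∑ j ∈ range k, P (s + 1 - (k : ZMod N) + (j : ZMod N))).PosSemidef)
    (hL : ∀ k, 1 ≤ k → k ≤ b →
      ((∑ j ∈ range k, P (s + 1 + (j : ZMod N))) * (∑ j ∈ range k, P (s + 1 + (j : ZMod N))) -
        (ε : ℂ) • ∑ j ∈ range k, P (s + 1 + (j : ZMod N))).PosSemidef)
    (i : ZMod N) :
    ((∑ j ∈ range b, P (i + (j : ZMod N))) * (∑ j ∈ range b, P (i + (j : ZMod N))) -
        (ε : ℂ) • ∑ j ∈ range b, P (i + (j : ZMod N))).PosSemidef := by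
  classical
  have hPpos : ∀ i, (P i).PosSemidef := fun i => posSemidef_of_isHermitian_of_mul_self (hherm i) (hidem i)
  -- residues `2 ≤ d ≤ b - 1 < N - 1` are `≠ 0, 1, -1`
  have hN1 : 1 ≤ N := by omega
  have hm1 : (-1 : ZMod N) = ((N - 1 : ℕ) : ZMod N) := by
    rw [Nat.cast_sub hN1, ZMod.natCast_self, zero_sub, Nat.cast_one]
  have hne0 : ∀ t : ℕ, 2 ≤ t → t < N - 1 → (t : ZMod N) ≠ 0 := fun t ht1 ht2 => by
    exact_mod_cast natCast_ne_natCast_zmod (N := N) (a := t) (b := 0) (by omega) (by omega)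
      (by omega)
  have hne1 : ∀ t : ℕ, 2 ≤ t → t < N - 1 → (t : ZMod N) ≠ 1 := fun t ht1 ht2 => by
    exact_mod_cast natCast_ne_natCast_zmod (N := N) (a := t) (b := 1) (by omega) (by omega)
      (by omega)
  have hnem1 : ∀ t : ℕ, 2 ≤ t → t < N - 1 → (t : ZMod N) ≠ -1 := fun t ht1 ht2 => by
    rw [hm1]
    exact natCast_ne_natCast_zmod (N := N) (by omega) (by omega) (by omega)
  by_cases hs : ∃ j < b, i + (j : ZMod N) = s
  · -- EDGE BLOCK containing `P_s` at position `j₀ = k - 1`: `A_i = R_k + L_{b-k}`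
    obtain ⟨j₀, hj₀b, hj₀⟩ := hs
    obtain ⟨k, hk⟩ : ∃ k : ℕ, k = j₀ + 1 := ⟨_, rfl⟩
    have hk1 : 1 ≤ k := by omega
    have hkb : k ≤ b := by omega
    have his : i = s + 1 - (k : ZMod N) := by
      rw [← hj₀, hk]; push_cast; ring
    have hik : i + (k : ZMod N) = s + 1 := by
      rw [← hj₀, hk]; push_cast; ring
    -- the two halves
    set R : Matrix n n ℂ := ∑ j ∈ range k, P (i + (j : ZMod N)) with hRdef
    set L : Matrix n n ℂ := ∑ j ∈ range (b - k), P (s + 1 + (j : ZMod N)) with hLdef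
    have hsplit : ∑ j ∈ range b, P (i + (j : ZMod N)) = R + L := by
      conv_lhs => rw [show b = k + (b - k) by omega, Finset.sum_range_add]
      congr 1
      refine Finset.sum_congr rfl fun j _ => ?_
      rw [← hik, Nat.cast_add, add_assoc]
    have hRpos : R.PosSemidef := posSemidef_sum _ fun j _ => hPpos _
    have hLpos : L.PosSemidef := posSemidef_sum _ fun j _ => hPpos _
    -- `R` has the right-edge gap
    have hRg : (R * R - (ε : ℂ) • R).PosSemidef := by
      have h := hR k hk1 hkb
      rw [← his] at h
      exact h
    -- `R` and `L` commute: the only adjacent pair across the split is the seam `(s, s+1)`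
    have hRL : Commute R L := by
      refine Commute.sum_left _ _ _ fun j hj => Commute.sum_right _ _ _ fun j' hj' => ?_
      rw [mem_range] at hj hj'
      -- `s + 1 + j' = (i + j) + d` with `d = k - j + j' ∈ [1, b-1]`
      obtain ⟨d, hd⟩ : ∃ d : ℕ, d = k - j + j' := ⟨_, rfl⟩
      have hd' : s + 1 + (j' : ZMod N) = i + (j : ZMod N) + (d : ZMod N) := by
        rw [← hik, hd, Nat.cast_add, Nat.cast_sub (by omega : j ≤ k)]
        ring
      rw [hd']
      by_cases hd1 : d = 1
      · -- the seam pair `P_s`, `P_{s+1}`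
        have hj0 : j = j₀ := by omega
        have hsj : i + (j : ZMod N) = s := by rw [hj0]; exact hj₀
        rw [hd1, Nat.cast_one, hsj]
        exact hseam
      · exact hcomm _ _ (hne0 d (by omega) (by omega)) (hne1 d (by omega) (by omega))
          (hnem1 d (by omega) (by omega))
    rw [hsplit]
    by_cases hbk : b - k = 0
    · -- the block ends exactly at the seam: `A_i = R_b`
      have hL0 : L = 0 := by rw [hLdef, hbk, sum_range_zero]
      rw [hL0, add_zero]
      exact hRg
    · have hLg : (L * L - (ε : ℂ) • L).PosSemidef := hL (b - k) (by omega) (by omega)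
      exact add_mul_add_sub_smul_posSemidef_of_commute hRpos hLpos hRL ε hRg hLg
  · push Not at hs
    by_cases hs1 : ∃ j < b, i + (j : ZMod N) = s + 1
    · -- the block starts right after the seam: `i = s + 1`, `A_i = L_b`
      obtain ⟨j₁, hj₁b, hj₁⟩ := hs1
      have hj₁0 : j₁ = 0 := by
        by_contra hne
        have h := hs (j₁ - 1) (by omega)
        apply h
        have : (j₁ : ZMod N) = ((j₁ - 1 : ℕ) : ZMod N) + 1 := by
          rw [Nat.cast_sub (by omega : 1 ≤ j₁), Nat.cast_one]; ring
        have h2 : i + ((j₁ - 1 : ℕ) : ZMod N) + 1 = s + 1 := by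
          rw [← hj₁, this]; ring
        exact add_right_cancel h2
      have hi : i = s + 1 := by
        rw [← hj₁, hj₁0, Nat.cast_zero, add_zero]
      rw [hi]
      exact hL b hb le_rfl
    · push Not at hs1
      exact hbulk i hs hs1

/-! ### The finite-size criterion for the chain with boundary -/

/-- ★★ **Lemm–Mozgunov's finite-size criterion for frustration-free chains with boundary, with the
Gosset–Mozgunov threshold.**  In the setting of `lemmMozgunov_block_sq_sub_smul_posSemidef` (ring `ℤ/N`,
`N = m + 1`, of the open chain's `m - 1` bond projections and its two boundary projectors placed at a commuting
seam `(s, s+1)`; bulk gap `ε` on `b` consecutive bonds, edge gaps `ε` on the `≤ b` bonds adjacent to the seam on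
either side — i.e. `ε = min{γ^B_n, γ^E_{n-1}}`, `n = b + 1`), for `b ≥ 2` and `N ≥ max(b + 2, 2b - 1)`:
`H² - (5(b+1)(b+2) / (6(b-1)(b+3))) (ε - 6/((b+1)(b+2))) H ≥ 0`, `H = Σ_i P_i` (`= H_m` of eq. (4.3)).
The printed Theorem 2.2 has the weaker threshold `2√6 n^{-3/2}` and constant `2⁻⁸(6n)^{-1/2}`
(`lemmMozgunov_thm22_sq_sub_smul_posSemidef`); the `Θ(n⁻²)` threshold for open chains is Anshu's Thm. 4.1, here
obtained along the Gosset–Mozgunov route (their weights and the tree's translation-free summed Lemma 4).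
[cite: LemmMozgunov2019, §2.3 Thm. 2.2 with §4.3 Prop. 4.3, §4.4 Prop. 4.4, §4.5 (4.22)]
[cite: GossetMozgunov2016, Thm. 3 and §2.2] [cite: Anshu2020, Thm. 4.1] -/
theorem lemmMozgunov_ring_sq_sub_smul_posSemidef {N : ℕ} [NeZero N] {b : ℕ} (hb : 2 ≤ b)
    (hN : b + 2 ≤ N) (hN2 : 2 * b ≤ N + 1) (P : ZMod N → Matrix n n ℂ)
    (hherm : ∀ i, (P i).IsHermitian) (hidem : ∀ i, P i * P i = P i)
    (hcomm : ∀ i d : ZMod N, d ≠ 0 → d ≠ 1 → d ≠ -1 → P i * P (i + d) = P (i + d) * P i)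
    (s : ZMod N) (hseam : P s * P (s + 1) = P (s + 1) * P s) {ε : ℝ} (hε : 0 < ε)
    (hbulk : ∀ i : ZMod N, (∀ j < b, i + (j : ZMod N) ≠ s) → (∀ j < b, i + (j : ZMod N) ≠ s + 1) →
      ((∑ j ∈ range b, P (i + (j : ZMod N))) * (∑ j ∈ range b, P (i + (j : ZMod N))) -
        (ε : ℂ) • ∑ j ∈ range b, P (i + (j : ZMod N))).PosSemidef)
    (hR : ∀ k, 1 ≤ k → k ≤ b →
      ((∑ j ∈ range k, P (s + 1 - (k : ZMod N) + (j : ZMod N))) *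
          (∑ j ∈ range k, P (s + 1 - (k : ZMod N) + (j : ZMod N))) -
        (ε : ℂ) • ∑ j ∈ range k, P (s + 1 - (k : ZMod N) + (j : ZMod N))).PosSemidef)
    (hL : ∀ k, 1 ≤ k → k ≤ b →
      ((∑ j ∈ range k, P (s + 1 + (j : ZMod N))) * (∑ j ∈ range k, P (s + 1 + (j : ZMod N))) -
        (ε : ℂ) • ∑ j ∈ range k, P (s + 1 + (j : ZMod N))).PosSemidef) :
    ((∑ i, P i) * (∑ i, P i) -
      ((5 * ((b : ℝ) + 1) * ((b : ℝ) + 2) / (6 * ((b : ℝ) - 1) * ((b : ℝ) + 3)) *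
          (ε - 6 / (((b : ℝ) + 1) * ((b : ℝ) + 2))) : ℝ) : ℂ) • ∑ i, P i).PosSemidef :=
  gossetMozgunov_ring_sq_sub_smul_posSemidef hb hN hN2 P hherm hidem hcomm hε
    (lemmMozgunov_block_sq_sub_smul_posSemidef (by omega) hN P hherm hidem hcomm s hseam ε hbulk hR hL)

/-- **The same, parametrised by the number `n ≥ 3` of sites of a block** (`n - 1` bonds per block; ring of
`N = m + 1 ≥ max(n + 1, 2n - 3)` indices, implied by the printed `4 ≤ n ≤ m/2`):
`H² - (5/6)((n²+n)/(n²-4)) (ε - 6/(n(n+1))) H ≥ 0` with `ε = min{γ^B_n, γ^E_{n-1}}`.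
[cite: LemmMozgunov2019, §2.3 Thm. 2.2] [cite: GossetMozgunov2016, Thm. 3] [cite: Anshu2020, Thm. 4.1] -/
theorem lemmMozgunov_ring_sq_sub_smul_posSemidef_sites {N : ℕ} [NeZero N] {ns : ℕ} (hns : 3 ≤ ns)
    (hN : ns + 1 ≤ N) (hN2 : 2 * ns ≤ N + 3) (P : ZMod N → Matrix n n ℂ)
    (hherm : ∀ i, (P i).IsHermitian) (hidem : ∀ i, P i * P i = P i)
    (hcomm : ∀ i d : ZMod N, d ≠ 0 → d ≠ 1 → d ≠ -1 → P i * P (i + d) = P (i + d) * P i)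
    (s : ZMod N) (hseam : P s * P (s + 1) = P (s + 1) * P s) {ε : ℝ} (hε : 0 < ε)
    (hbulk : ∀ i : ZMod N, (∀ j < ns - 1, i + (j : ZMod N) ≠ s) →
      (∀ j < ns - 1, i + (j : ZMod N) ≠ s + 1) →
      ((∑ j ∈ range (ns - 1), P (i + (j : ZMod N))) * (∑ j ∈ range (ns - 1), P (i + (j : ZMod N))) -
        (ε : ℂ) • ∑ j ∈ range (ns - 1), P (i + (j : ZMod N))).PosSemidef)
    (hR : ∀ k, 1 ≤ k → k ≤ ns - 1 →
      ((∑ j ∈ range k, P (s + 1 - (k : ZMod N) + (j : ZMod N))) *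
          (∑ j ∈ range k, P (s + 1 - (k : ZMod N) + (j : ZMod N))) -
        (ε : ℂ) • ∑ j ∈ range k, P (s + 1 - (k : ZMod N) + (j : ZMod N))).PosSemidef)
    (hL : ∀ k, 1 ≤ k → k ≤ ns - 1 →
      ((∑ j ∈ range k, P (s + 1 + (j : ZMod N))) * (∑ j ∈ range k, P (s + 1 + (j : ZMod N))) -
        (ε : ℂ) • ∑ j ∈ range k, P (s + 1 + (j : ZMod N))).PosSemidef) :
    ((∑ i, P i) * (∑ i, P i) -
      ((5 / 6 * (((ns : ℝ) ^ 2 + ns) / ((ns : ℝ) ^ 2 - 4)) *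
          (ε - 6 / ((ns : ℝ) * ((ns : ℝ) + 1))) : ℝ) : ℂ) • ∑ i, P i).PosSemidef :=
  gossetMozgunov_ring_sq_sub_smul_posSemidef_sites hns hN hN2 P hherm hidem hcomm hε
    (lemmMozgunov_block_sq_sub_smul_posSemidef (by omega) (by omega) P hherm hidem hcomm s hseam ε
      hbulk hR hL)

/-- **Eigenvalue reading**: under the hypotheses of `lemmMozgunov_ring_sq_sub_smul_posSemidef`, every NON-ZERO
eigenvalue `μ` of `H = Σ_i P_i` — in particular the spectral gap `γ_m` of the frustration-free open chain — satisfies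
`μ ≥ (5(b+1)(b+2)/(6(b-1)(b+3))) (ε - 6/((b+1)(b+2)))`, `ε = min{γ^B_{b+1}, γ^E_b}`.
[cite: LemmMozgunov2019, §2.3 Thm. 2.2, §4.2 (4.6)] [cite: GossetMozgunov2016, Thm. 3] [cite: Anshu2020, Thm. 4.1] -/
theorem lemmMozgunov_ring_eigenvalue_eq_zero_or_le {N : ℕ} [NeZero N] {b : ℕ} (hb : 2 ≤ b)
    (hN : b + 2 ≤ N) (hN2 : 2 * b ≤ N + 1) (P : ZMod N → Matrix n n ℂ)
    (hherm : ∀ i, (P i).IsHermitian) (hidem : ∀ i, P i * P i = P i)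
    (hcomm : ∀ i d : ZMod N, d ≠ 0 → d ≠ 1 → d ≠ -1 → P i * P (i + d) = P (i + d) * P i)
    (s : ZMod N) (hseam : P s * P (s + 1) = P (s + 1) * P s) {ε : ℝ} (hε : 0 < ε)
    (hbulk : ∀ i : ZMod N, (∀ j < b, i + (j : ZMod N) ≠ s) → (∀ j < b, i + (j : ZMod N) ≠ s + 1) →
      ((∑ j ∈ range b, P (i + (j : ZMod N))) * (∑ j ∈ range b, P (i + (j : ZMod N))) -
        (ε : ℂ) • ∑ j ∈ range b, P (i + (j : ZMod N))).PosSemidef)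
    (hR : ∀ k, 1 ≤ k → k ≤ b →
      ((∑ j ∈ range k, P (s + 1 - (k : ZMod N) + (j : ZMod N))) *
          (∑ j ∈ range k, P (s + 1 - (k : ZMod N) + (j : ZMod N))) -
        (ε : ℂ) • ∑ j ∈ range k, P (s + 1 - (k : ZMod N) + (j : ZMod N))).PosSemidef)
    (hL : ∀ k, 1 ≤ k → k ≤ b →
      ((∑ j ∈ range k, P (s + 1 + (j : ZMod N))) * (∑ j ∈ range k, P (s + 1 + (j : ZMod N))) -
        (ε : ℂ) • ∑ j ∈ range k, P (s + 1 + (j : ZMod N))).PosSemidef)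
    {μ : ℝ} {v : n → ℂ} (hv : (∑ i, P i) *ᵥ v = (μ : ℂ) • v) (hv0 : v ≠ 0) :
    μ = 0 ∨ 5 * ((b : ℝ) + 1) * ((b : ℝ) + 2) / (6 * ((b : ℝ) - 1) * ((b : ℝ) + 3)) *
      (ε - 6 / (((b : ℝ) + 1) * ((b : ℝ) + 2))) ≤ μ := by
  have hH : (∑ i, P i).PosSemidef :=
    posSemidef_sum _ fun i _ => posSemidef_of_isHermitian_of_mul_self (hherm i) (hidem i)
  exact eigenvalue_eq_zero_or_le_of_sq_sub_smul_posSemidef hH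
    (lemmMozgunov_ring_sq_sub_smul_posSemidef hb hN hN2 P hherm hidem hcomm s hseam hε hbulk hR hL) hv
    hv0

/-! ### Theorem 2.2 with its printed constants, and Remark 2.3 (i) -/

/-- Comparison of constants: Gosset–Mozgunov's `(5/6)(n²+n)/(n²-4) ≥ 2⁻⁸ (6n)^{-1/2}` and
`6/(n(n+1)) ≤ 2√6 n^{-3/2}` for `n ≥ 4` (indeed `n ≥ 3`). [cite: LemmMozgunov2019, §4.6 (4.25)–(4.26)] -/
theorem lemmMozgunov_constants_le {ns : ℕ} (hns : 3 ≤ ns) :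
    1 / (2 ^ 8 * Real.sqrt (6 * ns)) ≤ 5 / 6 * (((ns : ℝ) ^ 2 + ns) / ((ns : ℝ) ^ 2 - 4)) ∧
      6 / ((ns : ℝ) * ((ns : ℝ) + 1)) ≤ 2 * Real.sqrt 6 / (ns : ℝ) ^ (3 / 2 : ℝ) := by
  have h3 : (3 : ℝ) ≤ ns := by exact_mod_cast hns
  have hn0 : (0 : ℝ) < ns := by linarith
  constructor
  · -- `1/(256 √(6n)) ≤ 1/256 ≤ 5/6 ≤ (5/6)(n²+n)/(n²-4)`
    have hs1 : 1 ≤ Real.sqrt (6 * ns) := by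
      rw [show (1 : ℝ) = Real.sqrt 1 by rw [Real.sqrt_one]]
      exact Real.sqrt_le_sqrt (by linarith)
    have hA : 1 / (2 ^ 8 * Real.sqrt (6 * ns)) ≤ 1 / 2 ^ 8 := by
      apply div_le_div_of_nonneg_left zero_le_one (by positivity)
      nlinarith
    have hB : (1 : ℝ) ≤ ((ns : ℝ) ^ 2 + ns) / ((ns : ℝ) ^ 2 - 4) := by
      rw [le_div_iff₀ (by nlinarith)]
      nlinarith
    nlinarith
  · -- `6/(n(n+1)) ≤ 2√6 / n^{3/2}` iff `3 √n ≤ √6 (n+1)`, and `9n ≤ 6(n+1)²`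
    have hsq6 : Real.sqrt 6 * Real.sqrt 6 = 6 := Real.mul_self_sqrt (by norm_num)
    have hsqn : Real.sqrt ns * Real.sqrt ns = ns := Real.mul_self_sqrt hn0.le
    have h32 : (ns : ℝ) ^ (3 / 2 : ℝ) = ns * Real.sqrt ns := by
      rw [show (3 / 2 : ℝ) = 1 + 1 / 2 by norm_num, Real.rpow_add hn0, Real.rpow_one,
        Real.sqrt_eq_rpow]
    rw [h32, div_le_div_iff₀ (by positivity) (by positivity)]
    -- `6 (n √n) ≤ 2√6 (n (n+1))`
    have hkey : 3 * Real.sqrt ns ≤ Real.sqrt 6 * ((ns : ℝ) + 1) := by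
      have h6pos : 0 ≤ Real.sqrt 6 := Real.sqrt_nonneg 6
      have hnpos : 0 ≤ Real.sqrt ns := Real.sqrt_nonneg _
      nlinarith [sq_nonneg (Real.sqrt 6 * ((ns : ℝ) + 1) - 3 * Real.sqrt ns),
        sq_nonneg (Real.sqrt ns), mul_nonneg h6pos hnpos]
    nlinarith [Real.sqrt_nonneg (ns : ℝ), Real.sqrt_nonneg (6 : ℝ)]

omit [DecidableEq n] in
/-- If `H ≥ 0` and `κ' ≤ 0` then `H² - κ'H ≥ 0` (a Knabe-type bound with a non-positive constant is void).
[cite: LemmMozgunov2019, §4.2 (4.6)] -/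
theorem sq_sub_smul_posSemidef_of_nonpos {H : Matrix n n ℂ} (hH : H.PosSemidef) {κ' : ℝ}
    (hκ' : κ' ≤ 0) : (H * H - (κ' : ℂ) • H).PosSemidef := by
  have hHH : (H * H).PosSemidef := by
    have h1 := posSemidef_conjTranspose_mul_self H
    rwa [hH.1.eq] at h1
  have hid : H * H - (κ' : ℂ) • H = H * H + ((-κ' : ℝ) : ℂ) • H := by
    rw [Complex.ofReal_neg, neg_smul, sub_eq_add_neg]
  rw [hid]
  exact hHH.add (hH.smul (Complex.zero_le_real.2 (by linarith)))

omit [DecidableEq n] in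
/-- Monotonicity of Knabe-type bounds in the constant: `H ≥ 0`, `H² - κH ≥ 0`, `κ' ≤ κ` ⇒ `H² - κ'H ≥ 0`.
[cite: LemmMozgunov2019, §4.2 (4.6)] -/
theorem sq_sub_smul_posSemidef_of_le {H : Matrix n n ℂ} (hH : H.PosSemidef) {κ κ' : ℝ} (hle : κ' ≤ κ)
    (hκ : (H * H - (κ : ℂ) • H).PosSemidef) : (H * H - (κ' : ℂ) • H).PosSemidef := by
  have hid : H * H - (κ' : ℂ) • H = (H * H - (κ : ℂ) • H) + ((κ - κ' : ℝ) : ℂ) • H := by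
    rw [Complex.ofReal_sub, sub_smul]
    abel
  rw [hid]
  exact hκ.add (hH.smul (Complex.zero_le_real.2 (by linarith)))

/-- ★ **Lemm–Mozgunov's Theorem 2.2 (Main result 1) with its printed constants, operator form**: for blocks of
`n ≥ 4` sites (`n - 1` bonds) on the seamed ring `ℤ/N` (`N = m + 1 ≥ max(n + 1, 2n - 3)`, implied by the printed
`m ≥ 8`, `4 ≤ n ≤ m/2`), bulk gap and edge gaps `≥ ε = min{γ^B_n, γ^E_{n-1}} > 0`:
`H_m² - (1/(2⁸ √(6n))) (ε - 2√6 n^{-3/2}) H_m ≥ 0` ("`γ_m ≥ (1/(2⁸√(6n)))(min{γ_n^B, γ_{n-1}^E} - 2√6 n^{-3/2})`",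
eq. (4.6)).  Corollary of `lemmMozgunov_ring_sq_sub_smul_posSemidef_sites` by `lemmMozgunov_constants_le`.
[cite: LemmMozgunov2019, §2.3 Thm. 2.2 (2.8), §4.2 (4.6)] -/
theorem lemmMozgunov_thm22_sq_sub_smul_posSemidef {N : ℕ} [NeZero N] {ns : ℕ} (hns : 4 ≤ ns)
    (hN : ns + 1 ≤ N) (hN2 : 2 * ns ≤ N + 3) (P : ZMod N → Matrix n n ℂ)
    (hherm : ∀ i, (P i).IsHermitian) (hidem : ∀ i, P i * P i = P i)
    (hcomm : ∀ i d : ZMod N, d ≠ 0 → d ≠ 1 → d ≠ -1 → P i * P (i + d) = P (i + d) * P i)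
    (s : ZMod N) (hseam : P s * P (s + 1) = P (s + 1) * P s) {ε : ℝ} (hε : 0 < ε)
    (hbulk : ∀ i : ZMod N, (∀ j < ns - 1, i + (j : ZMod N) ≠ s) →
      (∀ j < ns - 1, i + (j : ZMod N) ≠ s + 1) →
      ((∑ j ∈ range (ns - 1), P (i + (j : ZMod N))) * (∑ j ∈ range (ns - 1), P (i + (j : ZMod N))) -
        (ε : ℂ) • ∑ j ∈ range (ns - 1), P (i + (j : ZMod N))).PosSemidef)
    (hR : ∀ k, 1 ≤ k → k ≤ ns - 1 →
      ((∑ j ∈ range k, P (s + 1 - (k : ZMod N) + (j : ZMod N))) *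
          (∑ j ∈ range k, P (s + 1 - (k : ZMod N) + (j : ZMod N))) -
        (ε : ℂ) • ∑ j ∈ range k, P (s + 1 - (k : ZMod N) + (j : ZMod N))).PosSemidef)
    (hL : ∀ k, 1 ≤ k → k ≤ ns - 1 →
      ((∑ j ∈ range k, P (s + 1 + (j : ZMod N))) * (∑ j ∈ range k, P (s + 1 + (j : ZMod N))) -
        (ε : ℂ) • ∑ j ∈ range k, P (s + 1 + (j : ZMod N))).PosSemidef) :
    ((∑ i, P i) * (∑ i, P i) -
      ((1 / (2 ^ 8 * Real.sqrt (6 * ns)) * (ε - 2 * Real.sqrt 6 / (ns : ℝ) ^ (3 / 2 : ℝ)) : ℝ) : ℂ) •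
        ∑ i, P i).PosSemidef := by
  have hH : (∑ i, P i).PosSemidef :=
    posSemidef_sum _ fun i _ => posSemidef_of_isHermitian_of_mul_self (hherm i) (hidem i)
  have hGM := lemmMozgunov_ring_sq_sub_smul_posSemidef_sites (by omega) hN hN2 P hherm hidem hcomm s
    hseam hε hbulk hR hL
  obtain ⟨hF, hG⟩ := lemmMozgunov_constants_le (ns := ns) (by omega)
  set FLM : ℝ := 1 / (2 ^ 8 * Real.sqrt (6 * ns)) with hFLM
  set GLM : ℝ := 2 * Real.sqrt 6 / (ns : ℝ) ^ (3 / 2 : ℝ) with hGLM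
  set FGM : ℝ := 5 / 6 * (((ns : ℝ) ^ 2 + ns) / ((ns : ℝ) ^ 2 - 4)) with hFGM
  set GGM : ℝ := 6 / ((ns : ℝ) * ((ns : ℝ) + 1)) with hGGM
  have hFLM0 : 0 ≤ FLM := by rw [hFLM]; positivity
  by_cases hcase : ε - GLM ≤ 0
  · exact sq_sub_smul_posSemidef_of_nonpos hH (mul_nonpos_of_nonneg_of_nonpos hFLM0 hcase)
  · push Not at hcase
    refine sq_sub_smul_posSemidef_of_le hH ?_ hGM
    calc FLM * (ε - GLM) ≤ FGM * (ε - GLM) := by nlinarith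
      _ ≤ FGM * (ε - GGM) := by nlinarith

/-- ★ **Theorem 2.2 as printed (eigenvalue form)**: under the hypotheses of
`lemmMozgunov_thm22_sq_sub_smul_posSemidef`, every non-zero eigenvalue `μ` of `H_m` (in particular its spectral
gap `γ_m`) satisfies `μ ≥ (1/(2⁸√(6n))) (ε - 2√6 n^{-3/2})`, `ε = min{γ^B_n, γ^E_{n-1}}`.
[cite: LemmMozgunov2019, §2.3 Thm. 2.2 (2.8)] -/
theorem lemmMozgunov_thm22_eigenvalue_eq_zero_or_le {N : ℕ} [NeZero N] {ns : ℕ} (hns : 4 ≤ ns)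
    (hN : ns + 1 ≤ N) (hN2 : 2 * ns ≤ N + 3) (P : ZMod N → Matrix n n ℂ)
    (hherm : ∀ i, (P i).IsHermitian) (hidem : ∀ i, P i * P i = P i)
    (hcomm : ∀ i d : ZMod N, d ≠ 0 → d ≠ 1 → d ≠ -1 → P i * P (i + d) = P (i + d) * P i)
    (s : ZMod N) (hseam : P s * P (s + 1) = P (s + 1) * P s) {ε : ℝ} (hε : 0 < ε)
    (hbulk : ∀ i : ZMod N, (∀ j < ns - 1, i + (j : ZMod N) ≠ s) →
      (∀ j < ns - 1, i + (j : ZMod N) ≠ s + 1) →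
      ((∑ j ∈ range (ns - 1), P (i + (j : ZMod N))) * (∑ j ∈ range (ns - 1), P (i + (j : ZMod N))) -
        (ε : ℂ) • ∑ j ∈ range (ns - 1), P (i + (j : ZMod N))).PosSemidef)
    (hR : ∀ k, 1 ≤ k → k ≤ ns - 1 →
      ((∑ j ∈ range k, P (s + 1 - (k : ZMod N) + (j : ZMod N))) *
          (∑ j ∈ range k, P (s + 1 - (k : ZMod N) + (j : ZMod N))) -
        (ε : ℂ) • ∑ j ∈ range k, P (s + 1 - (k : ZMod N) + (j : ZMod N))).PosSemidef)
    (hL : ∀ k, 1 ≤ k → k ≤ ns - 1 →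
      ((∑ j ∈ range k, P (s + 1 + (j : ZMod N))) * (∑ j ∈ range k, P (s + 1 + (j : ZMod N))) -
        (ε : ℂ) • ∑ j ∈ range k, P (s + 1 + (j : ZMod N))).PosSemidef)
    {μ : ℝ} {v : n → ℂ} (hv : (∑ i, P i) *ᵥ v = (μ : ℂ) • v) (hv0 : v ≠ 0) :
    μ = 0 ∨ 1 / (2 ^ 8 * Real.sqrt (6 * ns)) * (ε - 2 * Real.sqrt 6 / (ns : ℝ) ^ (3 / 2 : ℝ)) ≤ μ := by
  have hH : (∑ i, P i).PosSemidef :=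
    posSemidef_sum _ fun i _ => posSemidef_of_isHermitian_of_mul_self (hherm i) (hidem i)
  exact eigenvalue_eq_zero_or_le_of_sq_sub_smul_posSemidef hH
    (lemmMozgunov_thm22_sq_sub_smul_posSemidef hns hN hN2 P hherm hidem hcomm s hseam hε hbulk hR hL)
    hv hv0

/-- **Remark 2.3 (i), the case `n = 3`** (blocks of two bonds): bulk gap and edge gaps `≥ ε` ⇒
`H_m² - 2(ε - 1/2) H_m ≥ 0`, i.e. "`γ_m ≥ 2 (min{γ_3^B, γ_2^E} - 1/2)`" — Knabe's block theorem
`knabe_ring_block_sq_sub_smul_posSemidef` with `b = 2` (`(2ε - 1)/(2 - 1) = 2(ε - 1/2)`) on the seamed ring.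
[cite: LemmMozgunov2019, §2.3 Rem. 2.3 (i), §4.6] [cite: Knabe1988, §2 Thm. 1] -/
theorem lemmMozgunov_rem23_sq_sub_smul_posSemidef {N : ℕ} [NeZero N] (hN : 4 ≤ N)
    (P : ZMod N → Matrix n n ℂ) (hherm : ∀ i, (P i).IsHermitian) (hidem : ∀ i, P i * P i = P i)
    (hcomm : ∀ i d : ZMod N, d ≠ 0 → d ≠ 1 → d ≠ -1 → P i * P (i + d) = P (i + d) * P i)
    (s : ZMod N) (hseam : P s * P (s + 1) = P (s + 1) * P s) (ε : ℝ)
    (hbulk : ∀ i : ZMod N, (∀ j : ℕ, j < 2 → i + (j : ZMod N) ≠ s) →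
      (∀ j : ℕ, j < 2 → i + (j : ZMod N) ≠ s + 1) →
      ((∑ j ∈ range 2, P (i + (j : ZMod N))) * (∑ j ∈ range 2, P (i + (j : ZMod N))) -
        (ε : ℂ) • ∑ j ∈ range 2, P (i + (j : ZMod N))).PosSemidef)
    (hR : ∀ k, 1 ≤ k → k ≤ 2 →
      ((∑ j ∈ range k, P (s + 1 - (k : ZMod N) + (j : ZMod N))) *
          (∑ j ∈ range k, P (s + 1 - (k : ZMod N) + (j : ZMod N))) -
        (ε : ℂ) • ∑ j ∈ range k, P (s + 1 - (k : ZMod N) + (j : ZMod N))).PosSemidef)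
    (hL : ∀ k, 1 ≤ k → k ≤ 2 →
      ((∑ j ∈ range k, P (s + 1 + (j : ZMod N))) * (∑ j ∈ range k, P (s + 1 + (j : ZMod N))) -
        (ε : ℂ) • ∑ j ∈ range k, P (s + 1 + (j : ZMod N))).PosSemidef) :
    ((∑ i, P i) * (∑ i, P i) - ((2 * (ε - 1 / 2) : ℝ) : ℂ) • ∑ i, P i).PosSemidef := by
  have h := knabe_ring_block_sq_sub_smul_posSemidef (b := 2) le_rfl (by omega) P hherm hidem hcomm ε
    (lemmMozgunov_block_sq_sub_smul_posSemidef (by omega) (by omega) P hherm hidem hcomm s hseam ε hbulk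
      hR hL)
  have hc : ((2 : ℕ) * ε - 1) / ((2 : ℕ) - 1 : ℝ) = 2 * (ε - 1 / 2) := by push_cast; ring
  rw [← hc]
  exact_mod_cast h

end LemmMozgunov

end Literature.MathematicalPhysics.QuantumLattice

end
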